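import Mathlib.Data.Matrix.Mul
import Mathlib.Algebra.BigOperators.Fin
import Literature.MathematicalPhysics.QuantumLattice.SpinSystem
import HarnessLib

/-!
# The double-row transfer matrix of the eight-vertex / six-vertex model on a strip
# (Hagendorf–Liénardy 2020, §3.1; Sklyanin 1988)

Topic `MathematicalPhysics/QuantumLattice`, vocabulary of `SpinSystem.lean` /
`FendleyYangSupercharge.lean` (`TensorIndex (Fin L) 2 = Fin L → Fin 2` the configurations of a chain
of length `L`, `0 : Fin 2 = |↑⟩`, `1 : Fin 2 = |↓⟩`; `Op (Fin L) 2` the `2^L × 2^L` complex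
matrices; `fendleyYangSupercharge L = 𝔔 = Σ_{j=1}^{L} (-1)^j q_j : V^L → V^{L+1}`).

DEFINITIONS (Hagendorf–Liénardy 2020, §3.1, verbatim transcription; real `def`s with bodies):
* `EightVertex.rMatrix a b c d` — the `R`-matrix of the eight-vertex model in the basis
  `|↑↑⟩, |↑↓⟩, |↓↑⟩, |↓↓⟩` of `V ⊗ V`: `R = [[a,0,0,d],[0,b,c,0],[0,c,b,0],[d,0,0,a]]` (HL2020 §3.1,
  first display); the six-vertex model is `d = 0`.
* operators on `V_0 ⊗ V^L` (auxiliary space `V_0 = V` first), as matrices indexed by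
  `Fin 2 × TensorIndex (Fin L) 2`: `EightVertex.auxSite j R = R_{0j}` (acts as `R` on the factors
  `V_0, V_j`, identity elsewhere), `EightVertex.auxOp K = K_0 = K ⊗ 1`, the partial trace
  `EightVertex.auxTrace A = tr_0 A : Op (Fin L) 2`;
* `EightVertex.monodromy R L = U_{0,[1,L]} = R_{0L} R_{0,L-1} ⋯ R_{01}` and
  `EightVertex.monodromyBar R L = Ū_{0,[1,L]} = R_{01} R_{02} ⋯ R_{0L}` (HL2020 §3.1, second
  display; sites are `j : Fin L`, site `j` of the paper being `j.val + 1`);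
* `EightVertex.doubleRowTransferMatrix R K⁺ K⁻ L = 𝒯 = tr_0 (K⁺_0 U_{0,[1,L]} K⁻_0 Ū_{0,[1,L]})`,
  Sklyanin's transfer matrix of the vertex model on a strip with `L` vertical lines and open
  boundary conditions encoded by the `K`-matrices `K^± : V → V` (HL2020 §3.1, third display;
  Sklyanin 1988);
* `SixVertex.kMinus a b = K⁻ = 1 + (b/(2a+b)) σ³`, `SixVertex.kPlus a b = K⁺ = 1 - (a/(a+2b)) σ³` —
  the `K`-matrices (DefKpm) of HL2020 (their eq. (1.8)/(9)) specialised to the six-vertex point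
  `d = 0`, `y = 0` (there `K⁻ = 1 + (1-|y|²)/(1+|y|²)·(b²-d²)/(2ab+b²+d²) σ³`,
  `K⁺ = 1 + (1-|y|²)/(1+|y|²)·(b²-c²)/(2ab+b²+c²) σ³`, and on the supersymmetric line with `d = 0`,
  `c² = a²+ab+b²`, one has `(b²-c²)/(2ab+b²+c²) = -a(a+b)/((a+b)(a+2b)) = -a/(a+2b)`);
  `σ³ = spinHalfPauli 2 = diag(1,-1)`;
* `SixVertex.transferMatrix a b c L` — the resulting transfer matrix of the six-vertex model on the
  strip.

This file is FACT-FREE (definitions and unfoldings only): routes that need only the transfer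
matrix import no named fact. HL2020 Prop. 3.7 (`𝒯 𝔔 = (a+b)² 𝔔 𝒯` at the six-vertex point `d = 0`,
`y = 0`, Weston–Yang 2017) is vendored over these definitions as the named fact
`HagendorfLienardy2020_transferMatrix_supercharge` in `SixVertexSupersymmetry.lean`, where the
numerical check of the transcription (index conventions, order of `U`, `Ū`, assignment of `K⁺`/`K⁻`,
partial trace) is also recorded. Note: the `K`-matrices are vendored in HL2020's normalisation
(`K(0) = 1`); Lean's `x/0 = 0` makes `kMinus`/`kPlus` silently equal to `1` when `2a+b = 0` resp.
`a+2b = 0`, so statements about them carry these non-degeneracy hypotheses.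

## References

* C. Hagendorf, J. Liénardy, *On the transfer matrix of the supersymmetric eight-vertex model. II.
  Open boundary conditions*, J. Stat. Mech. (2020) 033104 = arXiv:1911.03348: §3.1 (R-matrix,
  `U`, `Ū`, `𝒯`), eq. (DefKpm) of §1 (the `K`-matrices), §2 (local supercharges), Prop. 3.7.
  [HagendorfLienardy2020]
* R. Weston, J. Yang, *Lattice supersymmetry in the open XXZ model: an algebraic Bethe Ansatz
  analysis*, J. Stat. Mech. (2017) 123104 (the six-vertex case `d = 0`, `y = 0`). [WestonYang2017]
* C. Hagendorf, J. Liénardy, *Open spin chains with dynamic lattice supersymmetry*, J. Phys. A 50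
  (2017) 185202, §2 (the supercharge). [HagendorfLienardy2017]
-/

noncomputable section

open Matrix Complex Finset

namespace Literature.MathematicalPhysics.QuantumLattice

/-! ### The eight-vertex `R`-matrix and operators on `V_0 ⊗ V^L` -/

namespace EightVertex

/-- The **`R`-matrix of the eight-vertex model** with vertex weights `a, b, c, d`, an operator on
`V ⊗ V` written in the basis `|↑↑⟩, |↑↓⟩, |↓↑⟩, |↓↓⟩` (`(0,0), (0,1), (1,0), (1,1)`):
`R = [[a,0,0,d],[0,b,c,0],[0,c,b,0],[d,0,0,a]]`, i.e. `⟨s't'|R|st⟩ = a` if `s'=t'=s=t`, `b` if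
`(s',t') = (s,t)` with `s ≠ t`, `c` if `(s',t') = (t,s)` with `s ≠ t`, `d` if `s'=t' ≠ s=t`, and `0`
otherwise (HL2020 §3.1). The six-vertex model is `d = 0`. [cite: HagendorfLienardy2020, §3.1] -/
def rMatrix (a b c d : ℂ) : Matrix (Fin 2 × Fin 2) (Fin 2 × Fin 2) ℂ :=
  Matrix.of fun x y =>
    if x = y then (if x.1 = x.2 then a else b)
    else if x.1 ≠ x.2 ∧ y = (x.2, x.1) then c
    else if x.1 = x.2 ∧ y.1 = y.2 then d
    else 0

variable {L : ℕ}

/-- `R_{0j}`: the two-site operator `R` acting on the auxiliary factor `V_0` and the factor `V_j` of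
`V_0 ⊗ V^L`, identity on the other factors (HL2020 §3.1), as a matrix indexed by
`Fin 2 × TensorIndex (Fin L) 2` (auxiliary spin first). [cite: HagendorfLienardy2020, §3.1] -/
def auxSite (j : Fin L) (R : Matrix (Fin 2 × Fin 2) (Fin 2 × Fin 2) ℂ) :
    Matrix (Fin 2 × TensorIndex (Fin L) 2) (Fin 2 × TensorIndex (Fin L) 2) ℂ :=
  Matrix.of fun x y => if ∀ k, k ≠ j → x.2 k = y.2 k then R (x.1, x.2 j) (y.1, y.2 j) else 0

/-- `K_0 = K ⊗ 1`: a one-site operator acting on the auxiliary factor of `V_0 ⊗ V^L` (HL2020 §3.1).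
[cite: HagendorfLienardy2020, §3.1] -/
def auxOp (L : ℕ) (K : Matrix (Fin 2) (Fin 2) ℂ) :
    Matrix (Fin 2 × TensorIndex (Fin L) 2) (Fin 2 × TensorIndex (Fin L) 2) ℂ :=
  Matrix.of fun x y => if x.2 = y.2 then K x.1 y.1 else 0

/-- The partial trace `tr_0` over the auxiliary space: `⟨τ| tr_0 A |σ⟩ = Σ_s ⟨s,τ| A |s,σ⟩`
(HL2020 §3.1). [cite: HagendorfLienardy2020, §3.1] -/
def auxTrace (A : Matrix (Fin 2 × TensorIndex (Fin L) 2) (Fin 2 × TensorIndex (Fin L) 2) ℂ) :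
    Op (Fin L) 2 :=
  Matrix.of fun τ σ => ∑ s : Fin 2, A (s, τ) (s, σ)

/-- `U_{0,[1,L]} = R_{0L} R_{0,L-1} ⋯ R_{01}` (HL2020 §3.1; with `0`-based sites `j : Fin L` this is
`R_{0,L-1} ⋯ R_{0,0}`, the reversed list product). [cite: HagendorfLienardy2020, §3.1] -/
def monodromy (R : Matrix (Fin 2 × Fin 2) (Fin 2 × Fin 2) ℂ) (L : ℕ) :
    Matrix (Fin 2 × TensorIndex (Fin L) 2) (Fin 2 × TensorIndex (Fin L) 2) ℂ :=
  (List.ofFn fun j : Fin L => auxSite j R).reverse.prod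

/-- `Ū_{0,[1,L]} = R_{01} R_{02} ⋯ R_{0L}` (HL2020 §3.1). [cite: HagendorfLienardy2020, §3.1] -/
def monodromyBar (R : Matrix (Fin 2 × Fin 2) (Fin 2 × Fin 2) ℂ) (L : ℕ) :
    Matrix (Fin 2 × TensorIndex (Fin L) 2) (Fin 2 × TensorIndex (Fin L) 2) ℂ :=
  (List.ofFn fun j : Fin L => auxSite j R).prod

/-- **Sklyanin's double-row transfer matrix** of the vertex model with `R`-matrix `R` on a strip with
`L` vertical lines and open boundary conditions encoded by the `K`-matrices `K⁺, K⁻ : V → V`: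
`𝒯 = tr_0 (K⁺_0 U_{0,[1,L]} K⁻_0 Ū_{0,[1,L]}) : V^L → V^L` (HL2020 §3.1, third display; Sklyanin
1988). [cite: HagendorfLienardy2020, §3.1] -/
def doubleRowTransferMatrix (R : Matrix (Fin 2 × Fin 2) (Fin 2 × Fin 2) ℂ)
    (Kp Km : Matrix (Fin 2) (Fin 2) ℂ) (L : ℕ) : Op (Fin L) 2 :=
  auxTrace (auxOp L Kp * monodromy R L * auxOp L Km * monodromyBar R L)

/-! #### API (definitional unfoldings) -/

/-- Entries of the `R`-matrix (definitional unfolding). [folklore] -/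
theorem rMatrix_apply (a b c d : ℂ) (x y : Fin 2 × Fin 2) :
    rMatrix a b c d x y =
      if x = y then (if x.1 = x.2 then a else b)
      else if x.1 ≠ x.2 ∧ y = (x.2, x.1) then c
      else if x.1 = x.2 ∧ y.1 = y.2 then d
      else 0 := rfl

/-- The diagonal weights: `⟨↑↑|R|↑↑⟩ = ⟨↓↓|R|↓↓⟩ = a`. [cite: HagendorfLienardy2020, §3.1] -/
theorem rMatrix_apply_same (a b c d : ℂ) (s : Fin 2) : rMatrix a b c d (s, s) (s, s) = a := by
  simp [rMatrix]

/-- `⟨↑↓|R|↑↓⟩ = ⟨↓↑|R|↓↑⟩ = b`. [cite: HagendorfLienardy2020, §3.1] -/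
theorem rMatrix_apply_b (a b c d : ℂ) {s t : Fin 2} (h : s ≠ t) :
    rMatrix a b c d (s, t) (s, t) = b := by
  simp [rMatrix, h]

/-- `⟨↑↓|R|↓↑⟩ = ⟨↓↑|R|↑↓⟩ = c`. [cite: HagendorfLienardy2020, §3.1] -/
theorem rMatrix_apply_c (a b c d : ℂ) {s t : Fin 2} (h : s ≠ t) :
    rMatrix a b c d (s, t) (t, s) = c := by
  have h' : ((s, t) : Fin 2 × Fin 2) ≠ (t, s) := by
    intro hst; exact h (Prod.mk.inj hst).1
  simp [rMatrix, h, h']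

/-- `⟨↑↑|R|↓↓⟩ = ⟨↓↓|R|↑↑⟩ = d`. [cite: HagendorfLienardy2020, §3.1] -/
theorem rMatrix_apply_d (a b c d : ℂ) {s t : Fin 2} (h : s ≠ t) :
    rMatrix a b c d (s, s) (t, t) = d := by
  have h' : ((s, s) : Fin 2 × Fin 2) ≠ (t, t) := by
    intro hst; exact h (Prod.mk.inj hst).1
  simp [rMatrix, h']

/-- The `R`-matrix is symmetric under the exchange of the two tensor factors, `P R P = R`; in
particular it does not matter that the auxiliary factor is written first. [cite: HagendorfLienardy2020, §3.1] -/
theorem rMatrix_swap (a b c d : ℂ) (x y : Fin 2 × Fin 2) :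
    rMatrix a b c d x.swap y.swap = rMatrix a b c d x y := by
  obtain ⟨s', t'⟩ := x
  obtain ⟨s, t⟩ := y
  fin_cases s' <;> fin_cases t' <;> fin_cases s <;> fin_cases t <;> simp [rMatrix]

/-- Entries of `R_{0j}` (definitional unfolding). [folklore] -/
theorem auxSite_apply (j : Fin L) (R : Matrix (Fin 2 × Fin 2) (Fin 2 × Fin 2) ℂ)
    (x y : Fin 2 × TensorIndex (Fin L) 2) :
    auxSite j R x y = if ∀ k, k ≠ j → x.2 k = y.2 k then R (x.1, x.2 j) (y.1, y.2 j) else 0 := rfl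

/-- Entries of `K_0 = K ⊗ 1` (definitional unfolding). [folklore] -/
theorem auxOp_apply (K : Matrix (Fin 2) (Fin 2) ℂ) (x y : Fin 2 × TensorIndex (Fin L) 2) :
    auxOp L K x y = if x.2 = y.2 then K x.1 y.1 else 0 := rfl

/-- Entries of the partial trace (definitional unfolding). [folklore] -/
theorem auxTrace_apply
    (A : Matrix (Fin 2 × TensorIndex (Fin L) 2) (Fin 2 × TensorIndex (Fin L) 2) ℂ)
    (τ σ : TensorIndex (Fin L) 2) : auxTrace A τ σ = ∑ s : Fin 2, A (s, τ) (s, σ) := rfl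

/-- `K_0 = K ⊗ 1` is the identity for `K = 1`. [folklore] -/
theorem auxOp_one : auxOp L (1 : Matrix (Fin 2) (Fin 2) ℂ) = 1 := by
  ext x y
  by_cases h : x = y
  · subst h; simp [auxOp_apply]
  · rw [Matrix.one_apply_ne h, auxOp_apply]
    by_cases h2 : x.2 = y.2
    · have h1 : x.1 ≠ y.1 := fun h1 => h (Prod.ext h1 h2)
      simp [h2, h1]
    · simp [h2]

/-- On a strip with one vertical line, `U_{0,[1,1]} = Ū_{0,[1,1]} = R_{01}`. [cite: HagendorfLienardy2020, §3.1] -/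
theorem monodromy_one (R : Matrix (Fin 2 × Fin 2) (Fin 2 × Fin 2) ℂ) :
    monodromy R 1 = auxSite 0 R ∧ monodromyBar R 1 = auxSite 0 R := by
  simp [monodromy, monodromyBar, List.ofFn_succ]

/-- Unfolding of the double-row transfer matrix. [folklore] -/
theorem doubleRowTransferMatrix_def (R : Matrix (Fin 2 × Fin 2) (Fin 2 × Fin 2) ℂ)
    (Kp Km : Matrix (Fin 2) (Fin 2) ℂ) (L : ℕ) :
    doubleRowTransferMatrix R Kp Km L =
      auxTrace (auxOp L Kp * monodromy R L * auxOp L Km * monodromyBar R L) := rfl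

end EightVertex

/-! ### The six-vertex model at `Δ = -1/2` on a strip: `K`-matrices and transfer matrix -/

namespace SixVertex

/-- The `K`-matrix `K⁻ = 1 + (b/(2a+b)) σ³` (HL2020 eq. (DefKpm) at `d = 0`, `y = 0`).
[cite: HagendorfLienardy2020, §1 (DefKpm)] -/
def kMinus (a b : ℂ) : Matrix (Fin 2) (Fin 2) ℂ :=
  1 + (b / (2 * a + b)) • spinHalfPauli 2

/-- The `K`-matrix `K⁺ = 1 - (a/(a+2b)) σ³` (HL2020 eq. (DefKpm) at `d = 0`, `y = 0`, on the
supersymmetric line `c² = a² + ab + b²`, where `(b²-c²)/(2ab+b²+c²) = -a/(a+2b)`).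
[cite: HagendorfLienardy2020, §1 (DefKpm)] -/
def kPlus (a b : ℂ) : Matrix (Fin 2) (Fin 2) ℂ :=
  1 - (a / (a + 2 * b)) • spinHalfPauli 2

/-- The transfer matrix of the six-vertex model (weights `a, b, c`, `d = 0`) on a strip with `L`
vertical lines with the boundary `K`-matrices `kPlus a b`, `kMinus a b` (HL2020 §3.1 with (DefKpm)
at `d = 0`, `y = 0`). [cite: HagendorfLienardy2020, §3.1] -/
def transferMatrix (a b c : ℂ) (L : ℕ) : Op (Fin L) 2 :=
  EightVertex.doubleRowTransferMatrix (EightVertex.rMatrix a b c 0) (kPlus a b) (kMinus a b) L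

/-- `K⁻` is diagonal: `K⁻ = diag(1 + b/(2a+b), 1 - b/(2a+b))`. [cite: HagendorfLienardy2020, §1 (DefKpm)] -/
theorem kMinus_eq (a b : ℂ) :
    kMinus a b = !![1 + b / (2 * a + b), 0; 0, 1 - b / (2 * a + b)] := by
  ext i j
  fin_cases i <;> fin_cases j <;> simp [kMinus, spinHalfPauli, sub_eq_add_neg]

/-- `K⁺` is diagonal: `K⁺ = diag(1 - a/(a+2b), 1 + a/(a+2b))`. [cite: HagendorfLienardy2020, §1 (DefKpm)] -/
theorem kPlus_eq (a b : ℂ) :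
    kPlus a b = !![1 - a / (a + 2 * b), 0; 0, 1 + a / (a + 2 * b)] := by
  ext i j
  fin_cases i <;> fin_cases j <;> simp [kPlus, spinHalfPauli]

/-- Unfolding of the six-vertex transfer matrix. [folklore] -/
theorem transferMatrix_def (a b c : ℂ) (L : ℕ) :
    transferMatrix a b c L =
      EightVertex.doubleRowTransferMatrix (EightVertex.rMatrix a b c 0) (kPlus a b) (kMinus a b) L :=
  rfl

end SixVertex

end Literature.MathematicalPhysics.QuantumLattice
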